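import Literature.Barriers.CriticalPhenomena.PlaquetteWalkHoleRootRingOffWall
import Literature.Barriers.CriticalPhenomena.PlaquetteWalkHoleRootLawLWalls
import HarnessLib

/-!
# Barrier catalogue (SAWScalingLimit): LAW L AS ONE DICHOTOMY ON THE RING — a ring cell removed alone makes a kill
statement hold iff it is the far cell's outer neighbour or a boundary cell of the box

Assembly leaf (no new mechanism, no new definition) of `PlaquetteWalkHoleRootRingOffWall` (★ no off-wall ring cell other
than `farWW` kills a route, hole anywhere `≥ 2` from the walls) and `PlaquetteWalkHoleRootLawLWalls` (the wall files:
corners `PlaquetteWalkHoleRootLawLDichotomy`, shut rows `…ShutRow` / `…ShutRowEast`, the column below the hole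
`…PrefixWall`, western pockets on the wall `…WallPocket`, the east wall `…EastWall`) and the three-door law of
`PlaquetteWalkHoleRootFarCellLaw` (`ΩG.doors_of_wound_far`). Setting: the `m × n` box, the hole `h` at distance `≥ 2`
from every wall, the root plaquette `w = (h.1 + 1, h.2)` rooted at its `W` side, far cell `(h.1 − 1, h.2)`; ONE cell
`(x, y)` of the boundary ring of the hole's closed `5 × 5` neighbourhood removed. The four universal KILL statements at the
angle `θ` (`P₁`: every wound class-`B2a` under-walk is `w₂`-marked off the far cell; `P₂`: every wound over-walk is
`w₁`-marked; `P₃`: every wound under-walk is `w₁`-marked; `P₄`: every wound over-walk is `w₂`-marked) are spelled out.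

* §1 ★★★★ `lawL_box_ring_wall_kills` — if `(x, y)` is `farWW = (h.1 − 2, h.2)` or a BOUNDARY cell of the box (so the
  hole is at distance exactly `2` from that wall), then at every angle at least one of `P₁ … P₄` holds. The table (which
  statement, by which mechanism): `farWW` anywhere ⇒ no wound walk at all (a door of the far cell is closed), so all four
  hold vacuously; bottom wall `(h.2 = 2)`: `K_S2 ⇒ P₁` (corridor kill), the cell below `farSW ⇒` no wound under-walk
  (shut row) `⇒ P₁, P₃`, the cell below the hole `⇒` no wound under-walk (prefix wall) `⇒ P₁, P₃`, the cell below
  `rootS ⇒ P₃` (shut row east), `K_S1 ⇒ P₃`; top wall: the mirror (`P₂`, `P₄`); west wall `(h.1 = 2)`: `K_S2 ⇒ P₁`,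
  `pocketSW ⇒` no wound under-walk, `farWW`, `pocketNW ⇒` no wound over-walk, `K_N1 ⇒ P₂`; east wall `(h.1 + 3 = m)`:
  `K_S1 ⇒ P₃`, `pocketSE ⇒` every wound walk `w₁`-marked `⇒ P₂, P₃`, `rootE ⇒` no wound walk, `pocketNE ⇒` every wound
  walk `w₂`-marked `⇒ P₁, P₄`, `K_N2 ⇒ P₄`.
* §2 ★★★★★ `lawL_box_ring_kills_iff` — THE DICHOTOMY: for a ring cell `(x, y)` removed alone, at every angle,
  `P₁ ∨ P₂ ∨ P₃ ∨ P₄ ↔ (x, y) = farWW ∨ (x, y)` is a boundary cell of the box (`x = 0 ∨ x + 1 = m ∨ y = 0 ∨ y + 1 = n`);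
  (⇒) is `lawL_box_ring_offWall_not_killed`. The rooted-face hypothesis is `rootedFace_hroot_boxMinus_cell`.

So the lane's pre-registered LAW L («the corner cells kill iff they are boundary cells», FINDING-YB-KILL-FORCED-ZEROS §5)
ends as a biconditional on the whole ring with one named exception: the wall, not the cell, kills — except for the far
cell's outer neighbour, which unwinds everything wherever it is.

Not in print; venture lane «pcv-sawmu», seat b-step0 gen 27.

References: A. Glazman, I. Manolescu, arXiv:1708.00395v3, §1 (Fig. 2, the remark after eq. (1)), §2.1 and Lemma 2.1
[GlazmanManolescu2019]; A. Glazman, Electron. Commun. Probab. 20 (2015) no. 86, Lemma 3.1, proof pp. 6–7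
[Glazman2015WeightedSAW]; R. Courant, H. Robbins, *What is Mathematics?* (1941/1958), Ch. V Appendix §2 (the even–odd
rule) [CourantRobbins1958].
-/

noncomputable section

open Set Function Complex

namespace Literature.Barriers.CriticalPhenomena.PlaquetteWalk

open Literature.Probability.RandomPlanarGeometry.SAW.YangBaxter
open Real Complex

section RingDichotomy

variable {m n : ℕ} {h : Face}

/-- ★★★★ **LAW L ON THE WALL (and at `farWW`), PREDICATE LEVEL.** In the `m × n` box with the hole `h` at distance `≥ 2`
from every wall, remove the hole and ONE ring cell `(x, y)` which is either the far cell's outer neighbour `(h.1 − 2, h.2)`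
or a boundary cell of the box. Then at every angle at least one of the four universal kill statements of LAW L holds at
the far cell of the root plaquette `(h.1 + 1, h.2)` (table in the module docstring: a closed door, an emptied route, or a
corridor / pocket / shut-row mark). [cite: GlazmanManolescu2019, §1 (Fig. 2 and the remark after eq. (1)), §2.1, Lemma 2.1]
[cite: Glazman2015WeightedSAW, Lemma 3.1 (proof, pp. 6–7)] [cite: CourantRobbins1958, Ch. V Appendix §2 (the even–odd rule)] -/
theorem lawL_box_ring_wall_kills (hW : 2 ≤ h.1) (hE : h.1 + 3 ≤ m) (hS : 2 ≤ h.2) (hN : h.2 + 3 ≤ n) {x y : ℤ}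
    (hring : ((x = h.1 - 2 ∨ x = h.1 + 2) ∧ h.2 - 2 ≤ y ∧ y ≤ h.2 + 2) ∨
      ((y = h.2 - 2 ∨ y = h.2 + 2) ∧ h.1 - 2 ≤ x ∧ x ≤ h.1 + 2))
    (hwall : (x = h.1 - 2 ∧ y = h.2) ∨ x = 0 ∨ x + 1 = m ∨ y = 0 ∨ y + 1 = n)
    (hr : RootedFace (dom (boxMinus m n [h, (x, y)])) (Face.side (h.1 + 1, h.2) .W) (farW (h.1 + 1, h.2))) (θ : ℝ) :
    (∀ (ω : ΩG (dom (boxMinus m n [h, (x, y)])) (Face.side (h.1 + 1, h.2) .W) (farW (h.1 + 1, h.2))) (hb : ω.IsB2a),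
        ω.2.firstSideG = .S → ω.WE (fun _ => θ) ≠ excursionWinding θ ω.2.firstSideG (ω.z1 hr hb) ω.1 →
          ¬ω.2.W2FreeOff (farW (h.1 + 1, h.2))) ∨
      (∀ (ω : ΩG (dom (boxMinus m n [h, (x, y)])) (Face.side (h.1 + 1, h.2) .W) (farW (h.1 + 1, h.2))) (hb : ω.IsB2a),
        ω.2.firstSideG = .N → ω.WE (fun _ => θ) ≠ excursionWinding θ ω.2.firstSideG (ω.z1 hr hb) ω.1 →
          ¬ω.2.W1FreeOff (farW (h.1 + 1, h.2))) ∨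
      (∀ (ω : ΩG (dom (boxMinus m n [h, (x, y)])) (Face.side (h.1 + 1, h.2) .W) (farW (h.1 + 1, h.2))) (hb : ω.IsB2a),
        ω.2.firstSideG = .S → ω.WE (fun _ => θ) ≠ excursionWinding θ ω.2.firstSideG (ω.z1 hr hb) ω.1 →
          ¬ω.2.W1FreeOff (farW (h.1 + 1, h.2))) ∨
      (∀ (ω : ΩG (dom (boxMinus m n [h, (x, y)])) (Face.side (h.1 + 1, h.2) .W) (farW (h.1 + 1, h.2))) (hb : ω.IsB2a),
        ω.2.firstSideG = .N → ω.WE (fun _ => θ) ≠ excursionWinding θ ω.2.firstSideG (ω.z1 hr hb) ω.1 →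
          ¬ω.2.W2FreeOff (farW (h.1 + 1, h.2))) := by
  have hh : holeFaceW ((h.1 + 1, h.2) : Face) ∉ dom (boxMinus m n [h, (x, y)]) := by
    rw [holeFaceW_hroot]; exact not_mem_dom_boxMinus_of_mem (by simp)
  have hc : ((x, y) : Face) ∉ dom (boxMinus m n [h, (x, y)]) := not_mem_dom_boxMinus_of_mem (by simp)
  -- (0) the far cell's outer neighbour, wherever it is: a door of the far cell is closed, NO walk is wound
  by_cases hWW : x = h.1 - 2 ∧ y = h.2
  · obtain ⟨rfl, rfl⟩ := hWW
    refine Or.inl fun ω hb _ hWd _ => ?_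
    have hD := (ΩG.doors_of_wound_far hh ω hr hb hWd).2.2
    have e : farWW ((h.1 + 1, h.2) : Face) = (h.1 - 2, h.2) := Prod.ext (by simp only [farWW]; omega) rfl
    rw [e] at hD
    exact hc hD
  have hwall' : x = 0 ∨ x + 1 = m ∨ y = 0 ∨ y + 1 = n := by
    rcases hwall with hw | hw <;> [exact absurd hw hWW; exact hw]
  rcases hwall' with hx0 | hxm | hy0 | hyn
  · -- WEST WALL: `h.1 = 2`, the cell is `(0, y) = (h.1 - 2, y)`
    have hW2 : h.1 = 2 := by omega
    obtain rfl : x = h.1 - 2 := by omega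
    have hy : y = h.2 - 2 ∨ y = h.2 - 1 ∨ y = h.2 + 1 ∨ y = h.2 + 2 := by omega
    rcases hy with rfl | rfl | rfl | rfl
    · -- `K_S2` on the west wall: the under route is `w₂`-killed
      have T := lawL_box_under_w2_killed_iff (m := m) (n := n) hW hE hS hN
      have e : killSW ((h.1 + 1, h.2) : Face) = (h.1 - 2, h.2 - 2) :=
        Prod.ext (by simp only [killSW]; omega) (by simp only [killSW])
      rw [e] at T
      exact Or.inl ((T hr θ).2 (Or.inl hW2))
    · -- `pocketSW` on the west wall: NO wound under-walk
      refine Or.inl fun ω hb hSd hWd _ => hWd ?_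
      refine ΩG.WE_eq_excursionWinding_of_under_wallPocketSW hh ?_ (fun x hx => ?_) ω hr hb hSd θ
      · have e : pocketSW ((h.1 + 1, h.2) : Face) = (h.1 - 2, h.2 - 1) :=
          Prod.ext (by simp only [pocketSW]; omega) (by simp only [pocketSW])
        rw [e]; exact hc
      · left; intro hm; have hb' := (mem_dom_boxMinus.1 hm).1; simp only at hb' hx; omega
    · -- `pocketNW` on the west wall: NO wound over-walk
      refine Or.inr (Or.inl fun ω hb hNd hWd _ => hWd ?_)
      refine ΩG.WE_eq_excursionWinding_of_over_wallPocketNW hh ?_ (fun x hx => ?_) ω hr hb hNd θ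
      · have e : pocketNW ((h.1 + 1, h.2) : Face) = (h.1 - 2, h.2 + 1) :=
          Prod.ext (by simp only [pocketNW]; omega) (by simp only [pocketNW])
        rw [e]; exact hc
      · left; intro hm; have hb' := (mem_dom_boxMinus.1 hm).1; simp only at hb' hx; omega
    · -- `K_N1` on the west wall: the over route is `w₁`-killed
      have T := lawL_box_over_w1_killed_iff (m := m) (n := n) hW hE hS hN
      have e : killNW ((h.1 + 1, h.2) : Face) = (h.1 - 2, h.2 + 2) :=
        Prod.ext (by simp only [killNW]; omega) (by simp only [killNW])
      rw [e] at T
      exact Or.inr (Or.inl ((T hr θ).2 (Or.inl hW2)))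
  · -- EAST WALL: `h.1 + 3 = m`, the cell is `(m - 1, y) = (h.1 + 2, y)`
    have hE3 : h.1 + 3 = m := by omega
    obtain rfl : x = h.1 + 2 := by omega
    have hy : y = h.2 - 2 ∨ y = h.2 - 1 ∨ y = h.2 ∨ y = h.2 + 1 ∨ y = h.2 + 2 := by omega
    have heastS : ∀ x : ℤ, (h.1 + 1, h.2).1 + 2 ≤ x →
        ((x, (h.1 + 1, h.2).2) : Face) ∉ dom (boxMinus m n [h, (h.1 + 2, y)]) ∨
          ((x, (h.1 + 1, h.2).2 - 1) : Face) ∉ dom (boxMinus m n [h, (h.1 + 2, y)]) := by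
      intro x hx; left; intro hm; have hb' := (mem_dom_boxMinus.1 hm).1; simp only at hb' hx; omega
    have heastN : ∀ x : ℤ, (h.1 + 1, h.2).1 + 2 ≤ x →
        ((x, (h.1 + 1, h.2).2) : Face) ∉ dom (boxMinus m n [h, (h.1 + 2, y)]) ∨
          ((x, (h.1 + 1, h.2).2 + 1) : Face) ∉ dom (boxMinus m n [h, (h.1 + 2, y)]) := by
      intro x hx; left; intro hm; have hb' := (mem_dom_boxMinus.1 hm).1; simp only at hb' hx; omega
    rcases hy with rfl | rfl | rfl | rfl | rfl
    · -- `K_S1` on the east wall: the under route is `w₁`-killed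
      have T := lawL_box_under_w1_killed_iff (m := m) (n := n) hW hE hS hN
      have e : killSE ((h.1 + 1, h.2) : Face) = (h.1 + 2, h.2 - 2) :=
        Prod.ext (by simp only [killSE]; omega) (by simp only [killSE])
      rw [e] at T
      exact Or.inr (Or.inr (Or.inl ((T hr θ).2 (Or.inl hE3))))
    · -- `pocketSE` on the east wall: every wound walk is `w₁`-marked
      refine Or.inr (Or.inl fun ω hb _ hWd => ?_)
      refine ΩG.not_W1FreeOff_of_wound_eastWall hh (Or.inr ?_) heastS ω hr hb hWd
      have e : (((h.1 + 1, h.2) : Face).1 + 1, ((h.1 + 1, h.2) : Face).2 - 1) = ((h.1 + 2, h.2 - 1) : Face) :=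
        Prod.ext (by simp only; omega) rfl
      rw [e]; exact hc
    · -- `rootE` on the east wall: NO wound walk at all
      refine Or.inl fun ω hb _ hWd _ => hWd ?_
      refine ΩG.WE_eq_excursionWinding_of_eastWallRootE hh ?_ heastS ω hr hb θ
      have e : (((h.1 + 1, h.2) : Face).1 + 1, ((h.1 + 1, h.2) : Face).2) = ((h.1 + 2, h.2) : Face) :=
        Prod.ext (by simp only; omega) rfl
      rw [e]; exact hc
    · -- `pocketNE` on the east wall: every wound walk is `w₂`-marked
      refine Or.inl fun ω hb _ hWd => ?_
      refine ΩG.not_W2FreeOff_of_wound_eastWallNE hh (Or.inr ?_) heastN ω hr hb hWd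
      have e : (((h.1 + 1, h.2) : Face).1 + 1, ((h.1 + 1, h.2) : Face).2 + 1) = ((h.1 + 2, h.2 + 1) : Face) :=
        Prod.ext (by simp only; omega) rfl
      rw [e]; exact hc
    · -- `K_N2` on the east wall: the over route is `w₂`-killed
      have T := lawL_box_over_w2_killed_iff (m := m) (n := n) hW hE hS hN
      have e : killNE ((h.1 + 1, h.2) : Face) = (h.1 + 2, h.2 + 2) :=
        Prod.ext (by simp only [killNE]; omega) (by simp only [killNE])
      rw [e] at T
      exact Or.inr (Or.inr (Or.inr ((T hr θ).2 (Or.inl hE3))))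
  · -- BOTTOM WALL: `h.2 = 2`, the cell is `(x, 0) = (x, h.2 - 2)`
    have hS2 : h.2 = 2 := by omega
    subst hy0
    have hx : x = h.1 - 2 ∨ x = h.1 - 1 ∨ x = h.1 ∨ x = h.1 + 1 ∨ x = h.1 + 2 := by omega
    rcases hx with rfl | rfl | rfl | rfl | rfl
    · -- `K_S2` on the bottom wall
      have T := lawL_box_under_w2_killed_iff (m := m) (n := n) hW hE hS hN
      have e : killSW ((h.1 + 1, h.2) : Face) = (h.1 - 2, 0) :=
        Prod.ext (by simp only [killSW]; omega) (by simp only [killSW]; omega)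
      rw [e] at T
      exact Or.inl ((T hr θ).2 (Or.inr hS2))
    · -- the cell below `farSW`: NO wound under-walk (shut row)
      exact Or.inl fun ω hb hSd hWd _ => hWd (lawL_box_farSWS_not_wound_under hS2 hr ω hb hSd θ)
    · -- the cell below the hole: NO wound under-walk (prefix wall)
      exact Or.inl fun ω hb hSd hWd _ => hWd (lawL_box_holeSS_not_wound_under hS2 hr ω hb hSd θ)
    · -- the cell below `rootS`: the under route is `w₁`-killed (shut row east, empty corridor)
      refine Or.inr (Or.inr (Or.inl ?_))
      refine ΩG.under_w1_killed_of_shutRowE hh (Or.inr ?_)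
        (R := {c | c ∈ dom (boxMinus m n [h, (h.1 + 1, 0)]) ∧ h.1 + 2 ≤ c.1 ∧ c.2 ≤ h.2 - 3}) ?_ (fun y hy => ?_) hr θ
      · have e : ((((h.1 + 1, h.2) : Face).1, ((h.1 + 1, h.2) : Face).2 - 2) : Face) = (h.1 + 1, 0) :=
          Prod.ext (by simp only) (by simp only; omega)
        rw [e]; exact hc
      · intro c hc'
        simp only [Set.mem_setOf_eq] at hc'
        obtain ⟨hcD, -, hc2⟩ := hc'
        have hb' := (mem_dom_boxMinus.1 hcD).1
        omega
      · left; intro hm; have hb' := (mem_dom_boxMinus.1 hm).1; simp only at hb' hy; omega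
    · -- `K_S1` on the bottom wall
      have T := lawL_box_under_w1_killed_iff (m := m) (n := n) hW hE hS hN
      have e : killSE ((h.1 + 1, h.2) : Face) = (h.1 + 2, 0) :=
        Prod.ext (by simp only [killSE]; omega) (by simp only [killSE]; omega)
      rw [e] at T
      exact Or.inr (Or.inr (Or.inl ((T hr θ).2 (Or.inr hS2))))
  · -- TOP WALL: `h.2 + 3 = n`, the cell is `(x, n - 1) = (x, h.2 + 2)`
    have hN3 : h.2 + 3 = n := by omega
    obtain rfl : y = h.2 + 2 := by omega
    have hx : x = h.1 - 2 ∨ x = h.1 - 1 ∨ x = h.1 ∨ x = h.1 + 1 ∨ x = h.1 + 2 := by omega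
    rcases hx with rfl | rfl | rfl | rfl | rfl
    · -- `K_N1` on the top wall
      have T := lawL_box_over_w1_killed_iff (m := m) (n := n) hW hE hS hN
      have e : killNW ((h.1 + 1, h.2) : Face) = (h.1 - 2, h.2 + 2) :=
        Prod.ext (by simp only [killNW]; omega) (by simp only [killNW])
      rw [e] at T
      exact Or.inr (Or.inl ((T hr θ).2 (Or.inr hN3)))
    · -- the cell above `farNW`: NO wound over-walk (shut row, mirror)
      refine Or.inr (Or.inl fun ω hb hNd hWd _ => hWd ?_)
      refine ΩG.WE_eq_excursionWinding_of_over_farNWN hh ?_ (fun y hy => ?_) ω hr hb hNd θ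
      · have e : ((((h.1 + 1, h.2) : Face).1 - 2, ((h.1 + 1, h.2) : Face).2 + 2) : Face) = (h.1 - 1, h.2 + 2) :=
          Prod.ext (by simp only; omega) rfl
        rw [e]; exact hc
      · left; intro hm; have hb' := (mem_dom_boxMinus.1 hm).1; simp only at hb' hy; omega
    · -- the cell above the hole: NO wound over-walk (prefix wall, mirror)
      refine Or.inr (Or.inl fun ω hb hNd hWd _ => hWd ?_)
      refine ΩG.WE_eq_excursionWinding_of_over_holeColumnN hh (fun y hy hm => ?_) ω hr hb hNd θ
      have hb' := mem_dom_boxMinus.1 hm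
      simp only [List.mem_cons, List.not_mem_nil, or_false, not_or, Prod.mk.injEq] at hb' hy
      omega
    · -- the cell above `rootN`: the over route is `w₂`-killed (shut row east, mirror; empty corridor)
      refine Or.inr (Or.inr (Or.inr ?_))
      refine ΩG.over_w2_killed_of_shutRowNE hh (Or.inr ?_)
        (R := {c | c ∈ dom (boxMinus m n [h, (h.1 + 1, h.2 + 2)]) ∧ h.1 + 2 ≤ c.1 ∧ h.2 + 3 ≤ c.2}) ?_
        (fun y hy => ?_) hr θ
      · have e : ((((h.1 + 1, h.2) : Face).1, ((h.1 + 1, h.2) : Face).2 + 2) : Face) = (h.1 + 1, h.2 + 2) :=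
          Prod.ext (by simp only) rfl
        rw [e]; exact hc
      · intro c hc'
        simp only [Set.mem_setOf_eq] at hc'
        obtain ⟨hcD, -, hc2⟩ := hc'
        have hb' := (mem_dom_boxMinus.1 hcD).1
        omega
      · left; intro hm; have hb' := (mem_dom_boxMinus.1 hm).1; simp only at hb' hy; omega
    · -- `K_N2` on the top wall
      have T := lawL_box_over_w2_killed_iff (m := m) (n := n) hW hE hS hN
      have e : killNE ((h.1 + 1, h.2) : Face) = (h.1 + 2, h.2 + 2) :=
        Prod.ext (by simp only [killNE]; omega) (by simp only [killNE])
      rw [e] at T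
      exact Or.inr (Or.inr (Or.inr ((T hr θ).2 (Or.inr hN3))))

/-- ★★★★★ **LAW L AS ONE DICHOTOMY ON THE RING.** In the `m × n` box with the hole `h` at distance `≥ 2` from every wall,
remove the hole and ONE cell `(x, y)` of the boundary ring of its closed `5 × 5` neighbourhood. Then, at every angle
`θ`, SOME universal kill statement of LAW L holds at the far cell of the root plaquette `(h.1 + 1, h.2)` — every wound
under-walk `w₂`-marked, or every wound over-walk `w₁`-marked, or every wound under-walk `w₁`-marked, or every wound
over-walk `w₂`-marked — IF AND ONLY IF the cell is the far cell's outer neighbour `(h.1 − 2, h.2)` or a boundary cell of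
the box. (⇐) is `lawL_box_ring_wall_kills`; (⇒) is `lawL_box_ring_offWall_not_killed` (free wound witnesses of all four
types around every off-wall ring cell). [cite: GlazmanManolescu2019, §1 (Fig. 2 and the remark after eq. (1)), §2.1, §4.2, Lemma 2.1]
[cite: Glazman2015WeightedSAW, Lemma 3.1 (proof, pp. 6–7)] [cite: CourantRobbins1958, Ch. V Appendix §2 (the even–odd rule)] -/
theorem lawL_box_ring_kills_iff (hW : 2 ≤ h.1) (hE : h.1 + 3 ≤ m) (hS : 2 ≤ h.2) (hN : h.2 + 3 ≤ n) {x y : ℤ}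
    (hring : ((x = h.1 - 2 ∨ x = h.1 + 2) ∧ h.2 - 2 ≤ y ∧ y ≤ h.2 + 2) ∨
      ((y = h.2 - 2 ∨ y = h.2 + 2) ∧ h.1 - 2 ≤ x ∧ x ≤ h.1 + 2))
    (hr : RootedFace (dom (boxMinus m n [h, (x, y)])) (Face.side (h.1 + 1, h.2) .W) (farW (h.1 + 1, h.2))) (θ : ℝ) :
    ((∀ (ω : ΩG (dom (boxMinus m n [h, (x, y)])) (Face.side (h.1 + 1, h.2) .W) (farW (h.1 + 1, h.2))) (hb : ω.IsB2a),
        ω.2.firstSideG = .S → ω.WE (fun _ => θ) ≠ excursionWinding θ ω.2.firstSideG (ω.z1 hr hb) ω.1 →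
          ¬ω.2.W2FreeOff (farW (h.1 + 1, h.2))) ∨
      (∀ (ω : ΩG (dom (boxMinus m n [h, (x, y)])) (Face.side (h.1 + 1, h.2) .W) (farW (h.1 + 1, h.2))) (hb : ω.IsB2a),
        ω.2.firstSideG = .N → ω.WE (fun _ => θ) ≠ excursionWinding θ ω.2.firstSideG (ω.z1 hr hb) ω.1 →
          ¬ω.2.W1FreeOff (farW (h.1 + 1, h.2))) ∨
      (∀ (ω : ΩG (dom (boxMinus m n [h, (x, y)])) (Face.side (h.1 + 1, h.2) .W) (farW (h.1 + 1, h.2))) (hb : ω.IsB2a),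
        ω.2.firstSideG = .S → ω.WE (fun _ => θ) ≠ excursionWinding θ ω.2.firstSideG (ω.z1 hr hb) ω.1 →
          ¬ω.2.W1FreeOff (farW (h.1 + 1, h.2))) ∨
      (∀ (ω : ΩG (dom (boxMinus m n [h, (x, y)])) (Face.side (h.1 + 1, h.2) .W) (farW (h.1 + 1, h.2))) (hb : ω.IsB2a),
        ω.2.firstSideG = .N → ω.WE (fun _ => θ) ≠ excursionWinding θ ω.2.firstSideG (ω.z1 hr hb) ω.1 →
          ¬ω.2.W2FreeOff (farW (h.1 + 1, h.2)))) ↔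
      ((x = h.1 - 2 ∧ y = h.2) ∨ x = 0 ∨ x + 1 = m ∨ y = 0 ∨ y + 1 = n) := by
  refine ⟨fun hk => ?_, fun hwall => lawL_box_ring_wall_kills hW hE hS hN hring hwall hr θ⟩
  by_contra hoff
  simp only [not_or] at hoff
  obtain ⟨hWW, hx0, hxm, hy0, hyn⟩ := hoff
  obtain ⟨n1, n2, n3, n4⟩ :=
    lawL_box_ring_offWall_not_killed hW hE hS hN hring hWW ⟨by omega, by omega, by omega, by omega⟩ hr θ
  rcases hk with hk | hk | hk | hk
  · exact n1 hk
  · exact n2 hk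
  · exact n3 hk
  · exact n4 hk

end RingDichotomy

end Literature.Barriers.CriticalPhenomena.PlaquetteWalk
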